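import Summits.ABC.ABC.Theses.LopsidedSzpiroSplit
import Literature.Barriers.ABC.EpsilonCannotBeDropped

/-!
# `LopsidedABC` (stmt-ABC-18360): the `ε` in the exponent is load-bearing on every lopsided cell

Negative-side support lemmas for the crux `Summit.ABC.ABC.Theses.LopsidedSzpiroSplit.LopsidedABC`
(abc `c < K(ε)·rad(abc)^(1+ε)` restricted to the LOPSIDED triples `min(a,b) ≤ c^(1-ε)`), from the
refuter's crux attack at birth (2026-08-17):

* `abc_no_uniform_constant_one` — Granville–Tucker's family with the member `a = 1` EXPOSED in the
  statement (the catalogued `Literature.Barriers.ABC.abc_no_uniform_constant` hides it behind `∃ a`):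
  for every real `C` there are `b, c` with `IsABCTriple 1 b c` and `C · rad(1·b·c) < c`
  (`c = 2^{φ(p²)}`, `p² ∣ c - 1`).  These triples have `min(a,b) = 1 ≤ c^(1-ε)` for EVERY `ε ≤ 1`,
  i.e. they lie in every lopsided cell of the crux.
* `lopsidedABC_exponent_one_false` — hence for every scale `0 < ε ≤ 1` the crux's conclusion with the
  exponent `1 + ε` replaced by `1` (uniform constant, `ε` dropped from the exponent but KEPT in the
  lopsidedness threshold) is false; and
* `lopsidedABC_false_without_exponent_eps` — the crux with `ε` dropped from the exponent is false.

So any proof of `LopsidedABC` must use the `+ε` of the exponent even on the most lopsided sub-family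
`a = 1` (the lopsided-cell reading of the barrier `EpsilonCannotBeDropped`); the lopsided hypothesis
buys no uniformity in `K`.
-/

-- `Summit.<Summit>.<Problem>` is the mandated summit-side namespace (CONVENTIONS §2); for the
-- single-conjunct summit `ABC` the two coincide, so the duplicate `ABC.ABC` is deliberate.
set_option linter.dupNamespace false

namespace Summit.ABC.ABC.Theorems.LopsidedABC.Negative

open Literature.NumberTheory.DiophantineGeometry Literature.Barriers.ABC

/-- **Granville–Tucker's family, with `a = 1` exposed.** For every real `C` there is an abc triple
`(1, b, c)` with `C · rad(1·b·c) < c`: take a prime `p > 2C`, `n = φ(p²)`, `c = 2ⁿ`, `b = 2ⁿ - 1`;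
then `p² ∣ b` (Euler), so `rad · p ≤ 2b` (`rad_mul_prime_le_of_sq_dvd`) and `C · rad ≤ 2Cb/p < b < c`.
Same proof as `Literature.Barriers.ABC.abc_no_uniform_constant`, which only states `∃ a b c`.
[cite: GranvilleTucker2002, p. 1227] -/
theorem abc_no_uniform_constant_one (C : ℝ) :
    ∃ b c : ℕ, IsABCTriple 1 b c ∧ C * (rad 1 b c : ℝ) < c := by
  obtain ⟨p, hp_ge, hp⟩ := Nat.exists_infinite_primes (⌈2 * C⌉₊ + 3)
  set n := Nat.totient (p ^ 2) with hn
  have hcop : Nat.Coprime 2 (p ^ 2) :=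
    ((Nat.coprime_primes Nat.prime_two hp).mpr (by omega)).pow_right 2
  have hmod : 2 ^ n ≡ 1 [MOD p ^ 2] := Nat.ModEq.pow_totient hcop
  have h1le : 1 ≤ 2 ^ n := Nat.one_le_two_pow
  have hpb : p ^ 2 ∣ 2 ^ n - 1 := (Nat.modEq_iff_dvd' h1le).mp hmod.symm
  have hn0 : 0 < n := Nat.totient_pos.mpr (pow_pos hp.pos 2)
  have h2le : 2 ≤ 2 ^ n := by
    calc 2 = 2 ^ 1 := by norm_num
      _ ≤ 2 ^ n := Nat.pow_le_pow_right (by norm_num) hn0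
  set b := 2 ^ n - 1 with hb
  have hb_pos : 0 < b := by omega
  have hb_lt : b < 2 ^ n := by omega
  refine ⟨b, 2 ^ n, ⟨one_pos, hb_pos, by omega, Nat.coprime_one_left b⟩, ?_⟩
  have key : rad 1 b (2 ^ n) * p ≤ 2 * b := rad_mul_prime_le_of_sq_dvd n hp hb_pos hpb
  have keyR : (rad 1 b (2 ^ n) : ℝ) * p ≤ 2 * b := by exact_mod_cast key
  have hp_pos : (0 : ℝ) < p := by exact_mod_cast hp.pos
  have hpC : 2 * C < p := by
    have h1 := Nat.le_ceil (2 * C)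
    have h2 : ((⌈2 * C⌉₊ + 3 : ℕ) : ℝ) ≤ p := by exact_mod_cast hp_ge
    push_cast at h2
    linarith
  have hbR : (0 : ℝ) < b := by exact_mod_cast hb_pos
  have hbltR : (b : ℝ) < ((2 ^ n : ℕ) : ℝ) := by exact_mod_cast hb_lt
  rcases le_or_gt C 0 with hC | hC
  · calc C * (rad 1 b (2 ^ n) : ℝ) ≤ 0 :=
          mul_nonpos_of_nonpos_of_nonneg hC (Nat.cast_nonneg _)
      _ < b := hbR
      _ < ((2 ^ n : ℕ) : ℝ) := hbltR
  · have hrad : (rad 1 b (2 ^ n) : ℝ) ≤ 2 * b / p := by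
      rw [le_div_iff₀ hp_pos]; exact keyR
    have hratio : 2 * C / p < 1 := by
      rw [div_lt_one hp_pos]; exact hpC
    calc C * (rad 1 b (2 ^ n) : ℝ) ≤ C * (2 * b / p) := by gcongr
      _ = (2 * C / p) * b := by ring
      _ < 1 * b := by gcongr
      _ = b := one_mul _
      _ < ((2 ^ n : ℕ) : ℝ) := hbltR

/-- **Exponent `1` fails on every lopsided cell.** For every scale `0 < ε ≤ 1` there is NO constant `K`
with `c < K · rad(abc)` for all abc triples in the lopsided cell `min(a,b) ≤ c^(1-ε)`: the triples
`(1, b, c)` of `abc_no_uniform_constant_one` have `min = 1 ≤ c^(1-ε)`. [folklore] -/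
theorem lopsidedABC_exponent_one_false (ε : ℝ) (hε1 : ε ≤ 1) :
    ¬ ∃ K : ℝ, ∀ a b c : ℕ, IsABCTriple a b c → ((min a b : ℕ) : ℝ) ≤ (c : ℝ) ^ (1 - ε) →
        (c : ℝ) < K * ((rad a b c : ℕ) : ℝ) := by
  rintro ⟨K, hK⟩
  obtain ⟨b, c, ht, hlt⟩ := abc_no_uniform_constant_one K
  have hb1 : 1 ≤ b := ht.2.1
  have hmin : ((min 1 b : ℕ) : ℝ) = 1 := by
    rw [min_eq_left hb1]; norm_num
  have hc1 : (1 : ℝ) ≤ (c : ℝ) := by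
    have : 1 ≤ c := by have := ht.2.2.1; omega
    exact_mod_cast this
  have hlop : ((min 1 b : ℕ) : ℝ) ≤ (c : ℝ) ^ (1 - ε) := by
    rw [hmin]
    exact Real.one_le_rpow hc1 (by linarith)
  have := hK 1 b c ht hlop
  linarith

/-- **`ε` cannot be dropped from the exponent of `LopsidedABC`.** The crux with its conclusion
`c < K · rad^(1+ε)` strengthened to the `ε`-free `c < K · rad` (lopsidedness threshold
`min(a,b) ≤ c^(1-ε)` unchanged) is false — already at the single scale `ε = 1`. [folklore] -/
theorem lopsidedABC_false_without_exponent_eps :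
    ¬ ∀ ε : ℝ, 0 < ε → ∃ K : ℝ, 0 < K ∧ ∀ a b c : ℕ, IsABCTriple a b c →
        ((min a b : ℕ) : ℝ) ≤ (c : ℝ) ^ (1 - ε) → (c : ℝ) < K * ((rad a b c : ℕ) : ℝ) := by
  intro h
  obtain ⟨K, -, hK⟩ := h 1 one_pos
  exact lopsidedABC_exponent_one_false 1 le_rfl ⟨K, hK⟩

end Summit.ABC.ABC.Theorems.LopsidedABC.Negative
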